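import Mathlib
import Literature.AlgebraicGeometry.Resolution.FormalShear
import Summits.ResolutionOfSingularities.ResolutionOfSingularities.Theorems.WeightedInvariantLocalWeightedDropMonicDescentShear

/-!
# `WeightedInvariant.LocalWeightedDrop`, sub-stub N4″: the `u₂`-shear versus re-centrings, `u₁`-divisibility and composition (tools for the T-5′ tail)

Crux item stmt-ResolutionOfSingularities-8899 `LocalWeightedDrop` (route `ResolutionOfSingularities/WeightedInvariant`), door
`WeightedConstruction` stmt-ResolutionOfSingularities-0571.  [OURS · L1 W4.3, chain w43, lead prover; last small tools of `N4PRIME-PLAN.md` §9 for the tail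
assembly of T-5′ `stub_monicDescentNoChain`.]

* `shear_recentre` — the shear is a ring homomorphism: `shear h (A₀ + A₁ψ + ψ²) = shear h A₀ + shear h A₁ · shear h ψ + (shear h ψ)²`;
* `isPermissibleOne_shear` — `u₁ ∣ A₁ ∧ u₁² ∣ A₀` is preserved by every `u₂`-shear (the shear fixes `u₁`);
* `shear_shear_of_noY` — shears compose additively when the inner one is by a series in `u₁` only: `shear a (shear b A) = shear (a + b) A`
  (from `FormalShear.shear_shear`); in the tail: `shear (X 0 * h′) (shear (C λ) A) = shear (C λ + X 0 * h′) A`.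
-/

set_option linter.dupNamespace false -- mandated namespace of this single-conjunct summit

noncomputable section

namespace Summit.ResolutionOfSingularities.ResolutionOfSingularities.Theorems

namespace MonicDescent

open MvPowerSeries Literature.AlgebraicGeometry.Resolution

variable {k : Type} [Field k]

/-- The shear of a re-centred first component. -/
theorem shear_recentre (h A₀ A₁ ψ : MvPowerSeries (Fin 2) k) :
    shear h (A₀ + A₁ * ψ + ψ ^ 2) = shear h A₀ + shear h A₁ * shear h ψ + shear h ψ ^ 2 := by
  have hs : HasSubst ![(X 0 : MvPowerSeries (Fin 2) k), X 1 + X 0 * h] := hasSubst_of_constantCoeff_zero (constantCoeff_shearFamily h)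
  simp only [shear_eq, ← coe_substAlgHom hs, map_add, map_mul, map_pow]

/-- `u₁^c`-divisibility in terms of exponents is preserved by the shear. -/
theorem le_fst_shear_of_le_fst (h A : MvPowerSeries (Fin 2) k) (c : ℕ) (hA : ∀ e : Fin 2 →₀ ℕ, coeff e A ≠ 0 → c ≤ e 0) :
    ∀ e : Fin 2 →₀ ℕ, coeff e (shear h A) ≠ 0 → c ≤ e 0 := by
  have hdvd : X 0 ^ c ∣ A := by
    rw [X_pow_dvd_iff]
    intro m hm
    by_contra hne
    exact absurd (hA m hne) (not_le.mpr hm)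
  obtain ⟨B, rfl⟩ := hdvd
  intro e he
  by_contra hlt
  push Not at hlt
  apply he
  rw [shear_X_pow_mul]
  exact (X_pow_dvd_iff.mp (Dvd.intro _ rfl)) e hlt

/-- `V(y,u₁)` stays permissible under every `u₂`-shear. -/
theorem isPermissibleOne_shear (h : MvPowerSeries (Fin 2) k) {A₀ A₁ : MvPowerSeries (Fin 2) k} (hP : IsPermissibleOne A₀ A₁) :
    IsPermissibleOne (shear h A₀) (shear h A₁) :=
  ⟨le_fst_shear_of_le_fst h A₀ 2 hP.1, le_fst_shear_of_le_fst h A₁ 1 hP.2⟩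

/-- Shears compose additively when the inner shear is by a series in `u₁` only. -/
theorem shear_shear_of_noY (a b A : MvPowerSeries (Fin 2) k) (hb : ∀ e : Fin 2 →₀ ℕ, e 1 ≠ 0 → coeff e b = 0) :
    shear a (shear b A) = shear (a + b) A := by
  rw [shear_eq, shear_eq, shear_eq]
  have hbX : ∀ e : Fin 2 →₀ ℕ, e 1 ≠ 0 → coeff e (X 0 * b) = 0 := by
    intro e he
    rw [show (X 0 : MvPowerSeries (Fin 2) k) = monomial (Finsupp.single 0 1) 1 from (X_def 0), coeff_monomial_mul]
    split_ifs with hle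
    · rw [one_mul]
      apply hb
      have : (e - Finsupp.single 0 1 : Fin 2 →₀ ℕ) 1 = e 1 := by simp
      rw [this]; exact he
    · rfl
  have h := FormalShear.shear_shear (a := X 0 * a) (b := X 0 * b) hbX
    (by rw [map_mul, constantCoeff_X, zero_mul]) (by rw [map_mul, constantCoeff_X, zero_mul]) A
  rw [h, mul_add]

/-- The tail relation: `shear (X 0 * h′) (shear (C c) A) = shear (C c + X 0 * h′) A`. -/
theorem shear_X_mul_shear_C (h' A : MvPowerSeries (Fin 2) k) (c : k) :
    shear (X 0 * h') (shear (C c) A) = shear (C c + X 0 * h') A := by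
  rw [shear_shear_of_noY (X 0 * h') (C c) A (fun e he => by
    rw [coeff_C, if_neg]
    intro h0
    apply he
    rw [h0]
    rfl)]
  rw [add_comm]

end MonicDescent

end Summit.ResolutionOfSingularities.ResolutionOfSingularities.Theorems

end
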